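import Summits.KontsevichZagierPeriods.KontsevichZagierPeriods.Theorems.SoloInformedToricNondegenerate
import Literature.NumberTheory.Transcendental.KZDominatedFamilyRelations
import HarnessLib

/-!
# THEOREM ND with numerators: `[[0,1]ⁿ, P/Q]` for `P ∈ ℚ≥0[x]`, `Q` cube-nondegenerate

Solo programme `solo-KontsevichZagierPeriods-informed`, session s104.

THEOREM ND (`soloInformed_presentable_of_nondegenerate`) presents `[[0,1]ⁿ, x^p/Q]` inside the KZ
calculus for cube-nondegenerate `Q`.  This file adds numerators:

* `soloInformed_cubeNondegenerate_smul` — cube-nondegeneracy is invariant under `Q ↦ c • Q`,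
  `c ≠ 0`; `soloInformed_aeval_ne_zero_of_nondegenerate` — a cube-nondegenerate `Q` has no zero on
  `(0,1]ⁿ` (the weight `w = 0`);
* `soloInformed_presentable_of_nondegenerate_of_subset` — THEOREM ND for any domain `σ` with
  `(0,1)ⁿ ⊆ σ ⊆ [0,1]ⁿ` (same proof);
* `soloInformed_presentable_of_nonneg_numerator` — **THEOREM ND⁺**: for `P ∈ ℚ[x]` with
  non-negative coefficients and `Q` cube-nondegenerate, every `IntegralRep` on `[0,1]ⁿ` whose
  integrand is `P/Q` on the open cube is presentable.  Proof: pass to the open cube (null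
  boundary), split `P/Q = ∑_{a ∈ supp P} c_a x^a/Q` by integrand additivity (each truncation
  `P_t/Q`, `t ⊆ supp P`, is integrable by domination `0 ≤ P_t ≤ P` on `(0,1)ⁿ` — this is where the
  sign condition enters), and present each `c_a x^a/Q = x^a/(c_a⁻¹ Q)` by THEOREM ND;
* `soloInformed_cubeResolution_nonneg_numerator` — the same in the format of the cube crux.

Numerators of mixed sign need the integrability of the individual monomial quotients `x^a/Q`,
`a ∈ supp P`, which does follow from that of `P/Q` (pulled back to a toric chart the exponents
`Aᵀa` stay distinct and distinct real monomials do not cancel in `L¹`), but that Laurent-monomial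
integrability test is not proved here.

References: M. Kontsevich, D. Zagier, *Periods* (2001), §1.2 (rule (1): additivity);
J. Ayoub, EMS Newsl. 91 (2014), §2.2; A. G. Kouchnirenko, Invent. Math. 32 (1976) §1.
-/

noncomputable section

open scoped BigOperators
open MeasureTheory Set
open Literature.NumberTheory.Transcendental Literature.NumberTheory.Transcendental.KZ
open Literature.ModelTheory.ExponentialFields (IsSemialgebraic)
open Literature.AlgebraicGeometry.Resolution

namespace Summit.KontsevichZagierPeriods.KontsevichZagierPeriods.Theorems

variable {n : ℕ}

/-! ### Scaling and the weight `w = 0` -/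

open Classical in
/-- `in_w(c • Q) = c • in_w(Q)` for `c ≠ 0` (same support, scaled coefficients). [this work] -/
theorem soloInformed_initForm_smul (w : Fin n → ℕ) (Q : MvPolynomial (Fin n) ℚ) {c : ℚ}
    (hc : c ≠ 0) : soloInformedInitForm w (c • Q) = c • soloInformedInitForm w Q := by
  unfold soloInformedInitForm
  have hs : (c • Q).support = Q.support := MvPolynomial.support_smul_eq hc Q
  have hI : ∀ a, SoloInformedIsInit w (c • Q) a ↔ SoloInformedIsInit w Q a := fun a => by
    unfold SoloInformedIsInit
    rw [hs]
  have hf : (c • Q).support.filter (SoloInformedIsInit w (c • Q)) =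
      Q.support.filter (SoloInformedIsInit w Q) := by
    rw [hs]
    exact Finset.filter_congr fun a _ => hI a
  rw [hf, Finset.smul_sum]
  exact Finset.sum_congr rfl fun a _ => by
    rw [MvPolynomial.coeff_smul, MvPolynomial.smul_monomial]

/-- **Cube-nondegeneracy is invariant under scaling** `Q ↦ c • Q`, `c ≠ 0`. [this work] -/
theorem soloInformed_cubeNondegenerate_smul {Q : MvPolynomial (Fin n) ℚ}
    (hND : SoloInformedCubeNondegenerate Q) {c : ℚ} (hc : c ≠ 0) :
    SoloInformedCubeNondegenerate (c • Q) := by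
  intro w y hy
  rw [soloInformed_initForm_smul w Q hc, map_smul]
  exact smul_ne_zero hc (hND w y hy)

open Classical in
/-- `in_0(Q) = Q`. [this work] -/
theorem soloInformed_initForm_zero (Q : MvPolynomial (Fin n) ℚ) :
    soloInformedInitForm (0 : Fin n → ℕ) Q = Q := by
  unfold soloInformedInitForm
  have hf : Q.support.filter (SoloInformedIsInit (0 : Fin n → ℕ) Q) = Q.support :=
    Finset.filter_true_of_mem fun a _ b _ => by simp [soloInformedWDeg]
  rw [hf]
  exact Q.as_sum.symm

/-- A cube-nondegenerate polynomial has no zero on the half-open cube `(0,1]ⁿ`, in particular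
none on the open cube. [this work] -/
theorem soloInformed_aeval_ne_zero_of_nondegenerate {Q : MvPolynomial (Fin n) ℚ}
    (hND : SoloInformedCubeNondegenerate Q) {x : Fin n → ℝ} (hx : ∀ i, 0 < x i ∧ x i ≤ 1) :
    MvPolynomial.aeval x Q ≠ 0 := by
  have h := hND 0 x hx
  rwa [soloInformed_initForm_zero] at h

/-! ### THEOREM ND for domains between the open and the closed cube -/

/-- **THEOREM ND, sandwich version**: the conclusion of `soloInformed_presentable_of_nondegenerate`
for every `IntegralRep` whose domain `σ` satisfies `(0,1)ⁿ ⊆ σ ⊆ [0,1]ⁿ` (e.g. the open cube);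
the proof is the same (toric charts inside the open cube, null complement). [this work] -/
theorem soloInformed_presentable_of_nondegenerate_of_subset (p : Fin n → ℕ)
    (Q : MvPolynomial (Fin n) ℚ) (hND : SoloInformedCubeNondegenerate Q) (r : IntegralRep n)
    (hr₁ : soloInformedOpenCube n ⊆ r.domain) (hr₂ : r.domain ⊆ soloInformedCube n)
    (hri : EqOn r.integrand (fun x => (∏ j, x j ^ p j) / MvPolynomial.aeval x Q)
      (soloInformedOpenCube n)) :
    of r ∈ soloInformedPresentable := by
  classical
  have hQ0 : Q ≠ 0 := soloInformed_ne_zero_of_cubeNondegenerate hND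
  have hO := soloInformedOpenCube_eq_pi n
  obtain ⟨M, A, hdet, hdisj, hcov, hcmp⟩ :=
    MonomialCubeChart.exists_cube_charts_pairwise_comparable n
      (Q.support.image fun a : Fin n →₀ ℕ => (a : Fin n → ℕ))
  rw [← hO] at hdisj hcov
  have hne : Q.support.Nonempty :=
    Finset.nonempty_iff_ne_empty.2 fun h => hQ0 (MvPolynomial.support_eq_empty.1 h)
  have hmaps : ∀ c, MapsTo (fun (v : Fin n → ℝ) (i : Fin n) => ∏ j, v j ^ A c i j)
      (soloInformedOpenCube n) (soloInformedOpenCube n) := fun c => by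
    rw [hO]; exact monomialMap_mapsTo_pi_Ioo (hdet c)
  have himg : ∀ c, IsSemialgebraic ℚ
      ((fun (v : Fin n → ℝ) (i : Fin n) => ∏ j, v j ^ A c i j) '' soloInformedOpenCube n) :=
    fun c => IsSemialgebraicMapOn.isSemialgebraic_image_holds
      (isSemialgebraicMapOn_monomialMap (A c) (isSemialgebraic_soloInformedOpenCube n))
      Subset.rfl (isSemialgebraic_soloInformedOpenCube n)
  have hsub : ∀ c, (fun (v : Fin n → ℝ) (i : Fin n) => ∏ j, v j ^ A c i j) ''
      soloInformedOpenCube n ⊆ r.domain := fun c => (hmaps c).image_subset.trans hr₁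
  -- the chart pieces
  set R : Fin M → IntegralRep n := fun c =>
    r.restrict ((fun (v : Fin n → ℝ) (i : Fin n) => ∏ j, v j ^ A c i j) '' soloInformedOpenCube n)
      (himg c) (hsub c) with hR
  have hRdom : ∀ c, (R c).domain =
      (fun (v : Fin n → ℝ) (i : Fin n) => ∏ j, v j ^ A c i j) '' soloInformedOpenCube n :=
    fun c => rfl
  have hpiece : ∀ c, of (R c) ∈ soloInformedPresentable := by
    intro c
    obtain ⟨a₀, ha₀, hmin⟩ := soloInformed_exists_least_of_pairwise_comparable Q.support hne
      (fun (a : Fin n →₀ ℕ) (j : Fin n) => ∑ i, A c i j * a i) fun a ha b hb =>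
        hcmp c _ (Finset.mem_image_of_mem _ ha) _ (Finset.mem_image_of_mem _ hb)
    exact soloInformed_presentable_toricChart_of_ne (A c) (hdet c) p Q
      (fun j => ∑ i, A c i j * a₀ i) hmin
      (fun x hx => soloInformed_chartQuot_ne_zero_of_nondegenerate (A c) Q hND ha₀
        (fun j => rfl) hmin hx)
      (R c) (hRdom c) fun v hv => hri (hmaps c hv)
  -- gluing by domain additivity up to null sets
  have hU : (⋃ c ∈ (Finset.univ : Finset (Fin M)), (R c).domain) =
      ⋃ c, (fun (v : Fin n → ℝ) (i : Fin n) => ∏ j, v j ^ A c i j) '' soloInformedOpenCube n := by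
    simp only [Finset.mem_univ, Set.iUnion_true, hRdom]
  have hglue : of r - ∑ c, of (R c) ∈ relations := by
    refine of_sub_sum_of_mem_relations Finset.univ r R (fun c _ => ?_) (fun c _ _ _ => rfl) ?_ ?_
    · rw [hRdom, Set.sdiff_eq_empty.2 (hsub c)]; exact measure_empty
    · rw [hU]
      refine measure_mono_null (fun x hx => ?_)
        (measure_union_null (soloInformed_volume_cube_diff_openCube n) hcov)
      by_cases hxo : x ∈ soloInformedOpenCube n
      · exact Or.inr ⟨hxo, hx.2⟩
      · exact Or.inl ⟨hr₂ hx.1, hxo⟩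
    · intro c _ c' _ hcc'
      rw [hRdom, hRdom, (hdisj hcc').inter_eq]; exact measure_empty
  exact soloInformed_presentable_of_sub_mem hglue
    (soloInformed_presentable_sum _ _ fun c _ => hpiece c)

/-! ### Truncations of the numerator -/

/-- The truncation `P_t := ∑_{a ∈ t} coeff_a(P) · X^a` of `P` to a set `t` of exponents.
[this work] -/
def soloInformedTrunc (P : MvPolynomial (Fin n) ℚ) (t : Finset (Fin n →₀ ℕ)) :
    MvPolynomial (Fin n) ℚ :=
  ∑ a ∈ t, MvPolynomial.monomial a (MvPolynomial.coeff a P)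

/-- Evaluation of a truncation. [this work] -/
theorem soloInformed_aeval_trunc (P : MvPolynomial (Fin n) ℚ) (t : Finset (Fin n →₀ ℕ))
    (x : Fin n → ℝ) : MvPolynomial.aeval x (soloInformedTrunc P t) =
      ∑ a ∈ t, algebraMap ℚ ℝ (MvPolynomial.coeff a P) * ∏ i, x i ^ a i := by
  unfold soloInformedTrunc
  rw [map_sum]
  exact Finset.sum_congr rfl fun a _ => by
    rw [MvPolynomial.aeval_monomial, Finsupp.prod_fintype _ _ fun i => pow_zero _]

/-- `0 ≤ P_t(x) ≤ P(x)` on the open cube for `P` with non-negative coefficients and `t ⊆ supp P`,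
hence `|P_t(x)/Q(x)| ≤ |P(x)/Q(x)|`. [this work] -/
theorem soloInformed_abs_trunc_div_le (P Q : MvPolynomial (Fin n) ℚ)
    (hP : ∀ a, 0 ≤ MvPolynomial.coeff a P) {t : Finset (Fin n →₀ ℕ)} (ht : t ⊆ P.support)
    {x : Fin n → ℝ} (hx : x ∈ soloInformedOpenCube n) :
    |MvPolynomial.aeval x (soloInformedTrunc P t) / MvPolynomial.aeval x Q| ≤
      |MvPolynomial.aeval x P / MvPolynomial.aeval x Q| := by
  have hterm : ∀ a : Fin n →₀ ℕ,
      0 ≤ algebraMap ℚ ℝ (MvPolynomial.coeff a P) * ∏ i, x i ^ a i := fun a =>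
    mul_nonneg (by rw [eq_ratCast]; exact_mod_cast hP a)
      (Finset.prod_nonneg fun i _ => pow_nonneg (hx i).1.le _)
  have h0 : 0 ≤ MvPolynomial.aeval x (soloInformedTrunc P t) := by
    rw [soloInformed_aeval_trunc]; exact Finset.sum_nonneg fun a _ => hterm a
  have h1 : MvPolynomial.aeval x (soloInformedTrunc P t) ≤ MvPolynomial.aeval x P := by
    rw [soloInformed_aeval_trunc, soloInformed_aeval_eq_sum_support P x]
    exact Finset.sum_le_sum_of_subset_of_nonneg ht fun a _ _ => hterm a
  rw [abs_div, abs_div, abs_of_nonneg h0, abs_of_nonneg (h0.trans h1)]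
  exact div_le_div_of_nonneg_right h1 (abs_nonneg _)

/-- Integrability of `P_t/Q` on the open cube by domination. [this work] -/
theorem soloInformed_integrableOn_trunc_div (P Q : MvPolynomial (Fin n) ℚ)
    (hP : ∀ a, 0 ≤ MvPolynomial.coeff a P) {t : Finset (Fin n →₀ ℕ)} (ht : t ⊆ P.support)
    (hQ : ∀ x ∈ soloInformedOpenCube n, MvPolynomial.aeval x Q ≠ 0)
    (hint : IntegrableOn (fun x => MvPolynomial.aeval x P / MvPolynomial.aeval x Q)
      (soloInformedOpenCube n)) :
    IntegrableOn (fun x => MvPolynomial.aeval x (soloInformedTrunc P t) / MvPolynomial.aeval x Q)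
      (soloInformedOpenCube n) := by
  have hmeas : MeasurableSet (soloInformedOpenCube n) := by
    rw [soloInformedOpenCube_eq_pi]; exact MeasurableSet.univ_pi fun _ => measurableSet_Ioo
  have hc : ∀ S : MvPolynomial (Fin n) ℚ, Continuous fun v : Fin n → ℝ =>
      (MvPolynomial.aeval v S : ℝ) := fun S => by
    have h : (fun v : Fin n → ℝ => (MvPolynomial.aeval v S : ℝ)) =
        fun v => MvPolynomial.eval v (MvPolynomial.map (algebraMap ℚ ℝ) S) :=
      funext fun v => by rw [MvPolynomial.eval_map, MvPolynomial.aeval_def]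
    rw [h]
    exact MvPolynomial.continuous_eval _
  have hcont : ContinuousOn
      (fun x => MvPolynomial.aeval x (soloInformedTrunc P t) / MvPolynomial.aeval x Q)
      (soloInformedOpenCube n) :=
    (hc _).continuousOn.div (hc Q).continuousOn hQ
  refine Integrable.mono hint (hcont.aestronglyMeasurable hmeas)
    (ae_restrict_of_forall_mem hmeas fun x hx => ?_)
  rw [Real.norm_eq_abs, Real.norm_eq_abs]
  exact soloInformed_abs_trunc_div_le P Q hP ht hx

/-! ### THEOREM ND⁺ -/

/-- **THEOREM ND⁺ — non-negative numerators.**  Let `P, Q ∈ ℚ[x₁, …, xₙ]`, `P` with non-negative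
coefficients and `Q` cube-nondegenerate, and let `r` be an `IntegralRep` on `[0,1]ⁿ` whose
integrand is `P/Q` on the open cube.  Then `of r` is presentable: `k • of r − ∑ⱼ cⱼ • of ρⱼ ∈
KZ.relations` with `k ≠ 0` and cube integrals `ρⱼ` of real parts of germs holomorphic near the
closed cube. [this work] -/
theorem soloInformed_presentable_of_nonneg_numerator (P Q : MvPolynomial (Fin n) ℚ)
    (hP : ∀ a, 0 ≤ MvPolynomial.coeff a P) (hND : SoloInformedCubeNondegenerate Q)
    (r : IntegralRep n) (hr : r.domain = soloInformedCube n)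
    (hri : EqOn r.integrand (fun x => MvPolynomial.aeval x P / MvPolynomial.aeval x Q)
      (soloInformedOpenCube n)) :
    of r ∈ soloInformedPresentable := by
  classical
  have hQ : ∀ x ∈ soloInformedOpenCube n, MvPolynomial.aeval x Q ≠ 0 := fun x hx =>
    soloInformed_aeval_ne_zero_of_nondegenerate hND fun i => ⟨(hx i).1, (hx i).2.le⟩
  have hOsub : soloInformedOpenCube n ⊆ r.domain := hr ▸ soloInformedOpenCube_subset_cube n
  -- pass to the open cube
  set r₀ := r.restrict (soloInformedOpenCube n) (isSemialgebraic_soloInformedOpenCube n) hOsub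
    with hr₀
  have h₀ : of r - of r₀ ∈ relations :=
    r.of_sub_of_restrict_mem_relations (isSemialgebraic_soloInformedOpenCube n) hOsub
      (by rw [hr]; exact soloInformed_volume_cube_diff_openCube n)
  have hint : IntegrableOn (fun x => MvPolynomial.aeval x P / MvPolynomial.aeval x Q)
      (soloInformedOpenCube n) :=
    r₀.integrableOn.congr_fun (fun x hx => hri hx) r₀.measurableSet_domain_holds
  -- the truncated representations `[(0,1)ⁿ, P_t/Q]`
  set ρ : Finset (Fin n →₀ ℕ) → IntegralRep n := fun t =>
    if ht : t ⊆ P.support then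
      IntegralRep.ofRational (soloInformedOpenCube n) (soloInformedTrunc P t) Q
        (isSemialgebraic_soloInformedOpenCube n) hQ
        (soloInformed_integrableOn_trunc_div P Q hP ht hQ hint)
    else r₀ with hρ
  have hρdom : ∀ t, (ρ t).domain = soloInformedOpenCube n := fun t => by
    by_cases ht : t ⊆ P.support
    · simp only [hρ, ht, dif_pos]; rfl
    · simp only [hρ, ht, dif_neg, not_false_eq_true]; rfl
  have hρi : ∀ t, t ⊆ P.support → ∀ x, (ρ t).integrand x =
      MvPolynomial.aeval x (soloInformedTrunc P t) / MvPolynomial.aeval x Q := fun t ht x => by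
    simp only [hρ, ht, dif_pos]; rfl
  -- integrand additivity along the support
  have hsplit : ∀ t, t ⊆ P.support → of (ρ t) - ∑ a ∈ t, of (ρ {a}) ∈ relations := by
    intro t
    induction t using Finset.induction_on with
    | empty =>
      intro _
      rw [Finset.sum_empty, sub_zero]
      exact of_mem_relations_of_eqOn_zero _ fun x _ => by
        rw [hρi ∅ (Finset.empty_subset _)]
        simp [soloInformedTrunc]
    | insert b t hb ih =>
      intro hbt
      have ht : t ⊆ P.support := (Finset.subset_insert b t).trans hbt
      have hb' : {b} ⊆ P.support :=
        Finset.singleton_subset_iff.2 (hbt (Finset.mem_insert_self b t))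
      have h1 : of (ρ (insert b t)) - of (ρ {b}) - of (ρ t) ∈ relations :=
        integrandAddRel_subset_relations ⟨n, ρ (insert b t), ρ {b}, ρ t,
          by rw [hρdom, hρdom], by rw [hρdom, hρdom], fun x _ => by
            rw [Pi.add_apply, hρi _ hbt, hρi _ hb', hρi _ ht, soloInformed_aeval_trunc,
              soloInformed_aeval_trunc, soloInformed_aeval_trunc, Finset.sum_insert hb,
              Finset.sum_singleton, add_div], rfl⟩
      rw [Finset.sum_insert hb]
      have : of (ρ (insert b t)) - (of (ρ {b}) + ∑ a ∈ t, of (ρ {a})) =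
          (of (ρ (insert b t)) - of (ρ {b}) - of (ρ t)) + (of (ρ t) - ∑ a ∈ t, of (ρ {a})) := by
        abel
      rw [this]
      exact relations.add_mem h1 (ih ht)
  -- `r₀` versus the full truncation
  have hfull : of r₀ - of (ρ P.support) ∈ relations :=
    of_sub_of_mem_relations_of_eqOn (by rw [hρdom]; rfl) fun x hx => by
      rw [hρi _ Subset.rfl]
      show r.integrand x = _
      rw [hri hx]
      unfold soloInformedTrunc
      rw [← MvPolynomial.as_sum P]
  -- each monomial piece by THEOREM ND
  have hpiece : ∀ a ∈ P.support, of (ρ {a}) ∈ soloInformedPresentable := by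
    intro a ha
    have hca : MvPolynomial.coeff a P ≠ 0 := MvPolynomial.mem_support_iff.1 ha
    have ha' : {a} ⊆ P.support := Finset.singleton_subset_iff.2 ha
    refine soloInformed_presentable_of_nondegenerate_of_subset a
      ((MvPolynomial.coeff a P)⁻¹ • Q) (soloInformed_cubeNondegenerate_smul hND (inv_ne_zero hca))
      (ρ {a}) (by rw [hρdom]) (by rw [hρdom]; exact soloInformedOpenCube_subset_cube n)
      fun x hx => ?_
    show _ = (∏ j, x j ^ a j) / MvPolynomial.aeval x ((MvPolynomial.coeff a P)⁻¹ • Q)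
    rw [hρi _ ha', soloInformed_aeval_trunc, Finset.sum_singleton, map_smul, Algebra.smul_def,
      eq_ratCast, eq_ratCast, Rat.cast_inv]
    have h1 : ((MvPolynomial.coeff a P : ℚ) : ℝ) ≠ 0 := by exact_mod_cast hca
    have h2 : MvPolynomial.aeval x Q ≠ 0 := hQ x hx
    field_simp
  -- assemble
  have hsum : ∑ a ∈ P.support, of (ρ {a}) ∈ soloInformedPresentable :=
    soloInformed_presentable_sum _ _ hpiece
  exact soloInformed_presentable_of_sub_mem h₀ (soloInformed_presentable_of_sub_mem hfull
    (soloInformed_presentable_of_sub_mem (hsplit _ Subset.rfl) hsum))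

/-- **THEOREM ND⁺ in the output format of the cube crux** `SoloInformedAyoubCubeResolutionCube`.
[this work] -/
theorem soloInformed_cubeResolution_nonneg_numerator (P Q : MvPolynomial (Fin n) ℚ)
    (hP : ∀ a, 0 ≤ MvPolynomial.coeff a P) (hND : SoloInformedCubeNondegenerate Q)
    (r : IntegralRep n) (hr : r.domain = soloInformedCube n)
    (hri : EqOn r.integrand (fun x => MvPolynomial.aeval x P / MvPolynomial.aeval x Q)
      (soloInformedOpenCube n)) :
    ∃ (k : ℕ) (_ : k ≠ 0) (m : ℕ) (d : Fin m → ℕ) (G : ∀ j, SoloInformedCubeGerm (d j))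
      (c : Fin m → ℤ) (ρ : ∀ j, IntegralRep (d j)),
      (∀ j, (ρ j).domain = soloInformedCube (d j)) ∧
      (∀ j, EqOn (ρ j).integrand (fun x => ((G j).g (soloInformedToC (d j) x)).re)
        (soloInformedCube (d j))) ∧
      k • of r - ∑ j, c j • of (ρ j) ∈ relations :=
  soloInformed_exists_fin_of_presentable
    (soloInformed_presentable_of_nonneg_numerator P Q hP hND r hr hri)

end Summit.KontsevichZagierPeriods.KontsevichZagierPeriods.Theorems
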